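/-
COR-CM (cell pub-hodgecm2, stage 2 of the Hodge ladder) — junction B01 `PerLFace_of_PerL`: VACUITY DISCIPLINE for the three
displayed leaves of the second-level split `CorCM/B01/FaceInputsSplit.lean` — `Universe.FaceSupply` (B01-S),
`Universe.HeckeWedge10` (B01-H), `Universe.FaceWedgeOverlap` (B01-O) — per RULING B01-SPLIT-2 (d) (lead gen 5,
2026-08-21T06:18Z).  Seat prover-pub-hodgecm2-own-b01-0 (single owner of B01).  Theorems only; nothing cited, nothing asserted.
-/
import Summits.HodgeConjecture.CorCM.B01.FaceInputsSplit
import Summits.HodgeConjecture.CorCM.B01.FaceInputsNonVacuity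
import HarnessLib

/-!
# B01 second-level leaves: binder-inhabitedness, necessity of the supply, and the shadow falsity of `FaceSupply`

* `Universe.faceSupply_of_faceLineField` / `faceSupply_of_periodThmF` — B01-S is NECESSARY: a non-zero wedge has non-zero
  factors, so `FaceLineField → FaceSupply`, hence `PeriodThmF → FaceSupply` (with `faceLineField_of_periodThmF`); the ∀-prefix of
  B01-S is that of `PeriodThmF` (`periodThmF_binders_inhabited`).
* `Universe.heckeWedge10_antecedent_of_faceSupply` — the antecedent of B01-H (two non-zero (1,0)-classes on some `P_Γ`) is
  inhabited as soon as B01-S holds (`U_Ψ ⊆ H^{1,0}`, `Uiso_le_piece10`, `Fact_pull_hodge`); on the model universe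
  `Fact_pull_hodge` is the tree theorem `Model.universeOf_fact_pull_hodge`.
* `Universe.faceWedgeOverlap_antecedent_of_supply_heckeWedge10` — the antecedent of B01-O is that of B01-C verbatim,
  inhabited under B01-L (the landed `faceSeesawCoupling_antecedent_of_faceLineField`), hence under B01-S ∧ B01-H.
* SHADOW: `Universe.not_faceSupply_perLShadow` — B01-S FAILS on the PerL shadow (`U_Ψ = ⊥` over `ℚ(ζ₇)`:
  `perLShadow_Uiso_eq_bot`), so `∀ U, U.PerL → U.FaceSupply` is false (`not_forall_perL_imp_faceSupply`, unconditional
  through `cmTypeUniverse`): ALL the model-specific falsity of B01-L sits in the supply leaf; B01-H and B01-O are conditional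
  leaves, vacuously true where no supply exists and read JOINTLY with B01-S (referee note (b) of ref-0 g24 applies verbatim).
-/

noncomputable section

open scoped TensorProduct
open NumberField

namespace Summit.HodgeConjecture.CorCM

open Literature.AlgebraicGeometry.Motives (CMType HodgeStructure)
open Literature.AlgebraicGeometry.Motives.HodgeStructure (EndAction conj)
open Literature.NumberTheory.Automorphic

namespace Universe

variable (U : Universe)

/-! ### B01-S is necessary -/

/-- **`FaceLineField → FaceSupply`**: a non-zero wedge `ω₀ ∪ ω₁` has non-zero factors. [folklore] -/
theorem faceSupply_of_faceLineField (h : U.FaceLineField) : U.FaceSupply := by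
  intro F hG h6 f ι₁ hf V
  obtain ⟨Γ, ω₀, ω₁, h₀, h₁, hne⟩ := h F hG h6 f ι₁ hf V
  refine ⟨Γ, ω₀, ω₁, h₀, h₁, ?_, ?_⟩
  · rintro rfl
    exact hne (by rw [map_zero, LinearMap.zero_apply])
  · rintro rfl
    exact hne (by rw [map_zero])

/-- **B01-S is necessary**: `PeriodThmF → FaceSupply` on every universe. [folklore] -/
theorem faceSupply_of_periodThmF (h : U.PeriodThmF) : U.FaceSupply :=
  U.faceSupply_of_faceLineField (U.faceLineField_of_periodThmF h)

/-! ### Antecedents of the conditional leaves are inhabited under the supply -/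

/-- **The antecedent of B01-H is inhabited under B01-S** (granted `Fact_pull_hodge`, so that `U_Ψ ⊆ H^{1,0}`): some Picard
modular surface of `U` carries two non-zero classes of bidegree (1,0). [folklore] -/
theorem heckeWedge10_antecedent_of_faceSupply (hH : U.Fact_pull_hodge) (hS : U.FaceSupply) :
    ∃ (L : CMField) (ι₁ : L →+* ℂ) (V : HermSpace3 L ι₁) (Γ : Level V) (a a' : U.CohC (U.pms L ι₁ V Γ) 1),
      a ∈ (U.hodge (U.pms L ι₁ V Γ) 1).piece 1 0 ∧ a' ∈ (U.hodge (U.pms L ι₁ V Γ) 1).piece 1 0 ∧ a ≠ 0 ∧ a' ≠ 0 := by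
  obtain ⟨F, hG, h6, f, ι₁, hf, V, -⟩ := periodThmF_binders_inhabited
  obtain ⟨Γ, ω₀, ω₁, h₀, h₁, hne₀, hne₁⟩ := hS F hG h6 f ι₁ hf V
  exact ⟨F, ι₁, V, Γ, ω₀, ω₁, Uiso_le_piece10 hH Γ F (f.psi 0) ι₁ h₀, Uiso_le_piece10 hH Γ F (f.psi 1) ι₁ h₁, hne₀, hne₁⟩

/- The antecedent of B01-O is that of B01-C verbatim: inhabited under B01-L by the landed
`Universe.faceSeesawCoupling_antecedent_of_faceLineField` (`FaceInputsNonVacuity.lean`; not restated). -/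

/-- The antecedent of B01-O is inhabited under B01-S ∧ B01-H (granted `Fact_pull_comp`, `Fact_pull_hodge`). [folklore] -/
theorem faceWedgeOverlap_antecedent_of_supply_heckeWedge10 (hc : U.Fact_pull_comp) (hH : U.Fact_pull_hodge)
    (hS : U.FaceSupply) (hW : U.HeckeWedge10) :
    ∃ (F : CMField) (_ : IsGalois ℚ F) (_ : 6 ≤ Module.finrank ℚ F) (f : Face F) (ι₁ : F →+* ℂ)
      (_ : f.Admissible ι₁) (V : HermSpace3 F ι₁) (Γ : Level V) (ω₀ ω₁ : U.CohC (U.pms F ι₁ V Γ) 1),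
      ω₀ ∈ U.Uiso Γ F (f.psi 0) ι₁ ∧ ω₁ ∈ U.Uiso Γ F (f.psi 1) ι₁ ∧ U.cup2C (U.pms F ι₁ V Γ) 1 ω₀ ω₁ ≠ 0 :=
  U.faceSeesawCoupling_antecedent_of_faceLineField (faceLineField_of_supply_of_heckeWedge10 hc hH hS hW)

/-! ### The shadow falsity of B01-S -/

/-- **B01-S FAILS on the PerL shadow** (of every universe, unconditionally): B01-S implies B01-L's supply half, and over
`ℚ(ζ₇)` every `U_Ψ(Γ)` of the shadow is `⊥`. [folklore] -/
theorem not_faceSupply_perLShadow : ¬ U.perLShadow.FaceSupply := by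
  intro h
  let F : CMField := ⟨CyclotomicField.{0} 7 ℚ⟩
  have hG : IsGalois ℚ F := isGalois_cyclotomicField_seven
  have h6 : Module.finrank ℚ F = 6 := UnitaryGroup.finrank_cyclotomicField_seven
  obtain ⟨f, ι₁, hf⟩ := exists_face_admissible F h6.ge
  obtain ⟨V⟩ := landherr_exists_proof F ι₁
  obtain ⟨Γ, ω₀, ω₁, h₀, -, hne₀, -⟩ := h F hG h6.ge f ι₁ hf V
  rw [U.perLShadow_Uiso_eq_bot (by omega) ι₁ V Γ F (f.psi 0) ι₁, Submodule.mem_bot] at h₀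
  exact hne₀ h₀

/-- **B01-S is not a universe-uniform consequence of `PerL`** (relative to M13 + M14). [folklore] -/
theorem not_forall_perL_imp_faceSupply (hE : U.Fact_eigenLine) (hA : U.Fact_alphaLine) :
    ¬ ∀ U' : Universe, U'.PerL → U'.FaceSupply :=
  fun h => U.not_faceSupply_perLShadow (h _ (U.perLShadow_perL hE hA))

end Universe

/-- **`PerL ∧ PerL44 ∧ ¬ FaceSupply` is satisfiable, unconditionally** (the PerL shadow of the CM-type universe). [folklore] -/
theorem exists_perL_perL44_not_faceSupply : ∃ U : Universe, U.PerL ∧ U.PerL44 ∧ ¬ U.FaceSupply :=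
  ⟨cmTypeUniverse.perLShadow, cmTypeUniverse.perLShadow_perL cmTypeUniverse_fact_eigenLine cmTypeUniverse_fact_alphaLine,
    cmTypeUniverse.perLShadow_perL44 cmTypeUniverse_fact_eigenLine cmTypeUniverse_fact_alphaLine,
    cmTypeUniverse.not_faceSupply_perLShadow⟩

/-- **B01-S is not a universe-uniform consequence of `PerL`, unconditionally.** [folklore] -/
theorem not_forall_perL_imp_faceSupply : ¬ ∀ U : Universe, U.PerL → U.FaceSupply := by
  intro h
  obtain ⟨U, hP, -, hS⟩ := exists_perL_perL44_not_faceSupply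
  exact hS (h U hP)

/-- **On the model universe: `PerLFace → FaceSupply`** and the antecedent of B01-H is inhabited under B01-S
(`Fact_pull_hodge` = `Model.universeOf_fact_pull_hodge`). [folklore] -/
theorem Model.heckeWedge10_antecedent_of_faceSupply (hHD : Literature.AlgebraicGeometry.HodgeTheory.exists_isReal_hodgeModel)
    (hI : Literature.AlgebraicGeometry.HodgeTheory.hodgePQ_independent_of_hodgeModel)
    (h₁ : PicardCM.BallQuotientUniformised) (h₃ : PicardCM.CMAbelianVarietyRealised)
    (hS : (Model.picardCMUniverse hHD hI h₁ h₃).FaceSupply) :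
    ∃ (L : CMField) (ι₁ : L →+* ℂ) (V : HermSpace3 L ι₁) (Γ : Level V)
      (a a' : (Model.picardCMUniverse hHD hI h₁ h₃).CohC ((Model.picardCMUniverse hHD hI h₁ h₃).pms L ι₁ V Γ) 1),
      a ∈ ((Model.picardCMUniverse hHD hI h₁ h₃).hodge _ 1).piece 1 0 ∧
        a' ∈ ((Model.picardCMUniverse hHD hI h₁ h₃).hodge _ 1).piece 1 0 ∧ a ≠ 0 ∧ a' ≠ 0 :=
  (Model.picardCMUniverse hHD hI h₁ h₃).heckeWedge10_antecedent_of_faceSupply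
    (Model.universeOf_fact_pull_hodge hHD hI (PicardCM.ballQuotientUniformisedDatum_of h₁) h₃) hS

end Summit.HodgeConjecture.CorCM

end
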